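import Literature.NumberTheory.EllipticCurves.BurungaleKobayashiNakamuraOta2026.RubinPadicLFunction
import Literature.NumberTheory.EllipticCurves.Rubin1991.TwoVariableCMLines
import HarnessLib

/-!
# Values of `𝒪_{ℂ_p}⟦T⟧`-elements on the open unit disc: existence, integrality, and the ULTRAMETRIC
# TRANSFER `‖ℒ(x) − ℒ(0)‖ ≤ ‖x‖` in the `IntSeries.HasValueAt` currency — with the instances for the
# Rubin-type `p`-adic `L`-function datum of Burungale–Kobayashi–Nakamura–Ota 2026 (PROOFS; no definition,
# no fact)

Topic `NumberTheory/EllipticCurves`, sub-directory `BurungaleKobayashiNakamuraOta2026`; companion of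
`RubinPadicLFunction.lean` (the datum `RubinPadicLFunctionData`, whose values `ξ(ℒ)` are typed as
`IntSeries.HasValueAt ℒ (ξ̂(γ) − 1) v`, `ℒ ∈ PowerSeries (PadicComplexInt p)`). Cell `bsd-cm`, K7r line
`rubin-formula-zp` (crux stmt-BirchSwinnertonDyer-19945): the RELATIVE RUBIN VALUATION THEOREM of the
memo `RELATIVE-RUBIN-ram-g9.md` §1 uses the elementary input (vi) "for `F ∈ 𝒪⟦X⟧` and `x ∈ 𝔪`:
`ord(F(x) − F(0)) ≥ ord x`, hence (a) `ord F(x) < ord x ⇒ ord F(0) = ord F(x)`, (b) `ord F(0) < ord x ⇒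
ord F(x) = ord F(0)`, (c) `ord F(x) ≥ min(ord F(0), ord x)`". The kernel has it for RING-HOMOMORPHISM
evaluations `ev : R⟦X⟧ →+* S` (`Summits/…/Theorems/RamifiedSevenEllipticUnitsUltrametricTransfer.lean`,
any `Valuation`; `IwasawaAlgebra p →ₐ ℤ_[p]`); this file proves it in the CONVERGENT-SUM currency of the
tree's `p`-adic `L`-function frames (`IntSeries.HasValueAt` = `HasSum (∑ [T^k]Q · x^k) v` in `ℂ_p`, used by
`IsBDPLFunction`, `IsKatzBranch`, `IsHsiehLFunction`, `RubinPadicLFunctionData`), where no evaluation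
homomorphism appears in the statements, so that the consumer can move between `‖ξ_k(ℒ)‖` and
`‖𝟙(ℒ)‖ = ‖[T⁰]ℒ‖` directly from the datum's fields.

## Contents (all PROVED; real norms on `ℂ_p`, multiplicative currency: `ord a < ord b ↔ ‖b‖ < ‖a‖`)

* §1 (`namespace …EllipticCurves.IntSeries`, any `Q : PowerSeries (PadicComplexInt p)`):
  `norm_term_le_pow` (`‖[T^k]Q · x^k‖ ≤ ‖x‖^k`), `summable_of_norm_lt_one`, `exists_hasValueAt`
  (values EXIST at every point of the open unit disc — the frames' `∃ v` clauses are never vacuous),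
  `norm_le_one_of_hasValueAt` (`‖Q(x)‖ ≤ 1` for `‖x‖ ≤ 1`), the TRANSFER `norm_sub_constantCoeff_le`
  (`‖Q(x) − [T⁰]Q‖ ≤ ‖x‖` for `‖x‖ ≤ 1`), and its consequences `norm_le_max` / `norm_constantCoeff_le_max`
  ((c)), `norm_constantCoeff_eq_of_lt` ((a): `‖x‖ < ‖Q(x)‖ → ‖[T⁰]Q‖ = ‖Q(x)‖`), `norm_eq_of_lt` ((b):
  `‖x‖ < ‖[T⁰]Q‖ → ‖Q(x)‖ = ‖[T⁰]Q‖`), `constantCoeff_ne_zero_of_lt` ((a)'s non-vanishing corollary).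
* §2 (`namespace …BurungaleKobayashiNakamuraOta2026.RubinPadicLFunctionData`): the instances for the
  datum — `exists_hasValueAt` (every point of the disc), `norm_constantCoeff_eq_of_lt` /
  `norm_eq_constantCoeff_of_lt` (memo THEOREM (2)/(3) shape: "`ord ℒ(ξ_k) < ord x_k ⇒ ord ℒ(𝟙) = ord ℒ(ξ_k)`"
  with `ℒ(𝟙) ≠ 0` certified, and the converse direction), and, under `ε(φ) = −1`, the same with `ℒ(𝟙)`
  replaced by `exp*_ω(𝟙(v_{−ε})) · log_ω(loc_𝔭 z(𝟙))` through the datum's `thm72_one`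
  (`norm_bottomPeriod_mul_logω_eq_of_lt`).

Nothing here is specific to elliptic curves except §2's packaging; BSD is not touched; no named fact.

## References

* L. Washington, *Introduction to Cyclotomic Fields*, §7.2 (power series over `𝒪`: `f(x) ≡ f(0) mod x`).
  [Washington1997]
* J.-P. Serre, *Local Fields*, Ch. II §1 (ultrametric inequality and its equality cases). [Serre1979]
* [BurungaleKobayashiNakamuraOta2026] arXiv:2608.06879, Thm. 4.12 and Thm. 7.2 (the values packaged in §2).
* Cell memo `pub/bsd-cm/bsd-cm-ram/g9/RELATIVE-RUBIN-ram-g9.md` §1 (vi) and THEOREM (2)–(4).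
-/

noncomputable section

open scoped Classical

open NumberField IsDedekindDomain Field
  Literature.NumberTheory.EllipticCurves Literature.NumberTheory.GaloisRepresentations

namespace Literature.NumberTheory.EllipticCurves

/-! ## §1. `IntSeries.HasValueAt` on the open unit disc: existence, integrality, ultrametric transfer -/

namespace IntSeries

variable {p : ℕ} [Fact p.Prime] (Q : PowerSeries (PadicComplexInt p))

/-- The terms `[T^k]Q · x^k` are dominated by the geometric sequence `‖x‖^k` (coefficients in `𝒪_{ℂ_p}`).
[cite: Washington1997, §7.2] -/
theorem norm_term_le_pow (x : ℂ_[p]) (k : ℕ) :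
    ‖((PowerSeries.coeff k Q : PadicComplexInt p) : ℂ_[p]) * x ^ k‖ ≤ ‖x‖ ^ k := by
  rw [norm_mul, norm_pow]
  exact mul_le_of_le_one_left (pow_nonneg (norm_nonneg _) _) (norm_coe_padicComplexInt_le_one _)

/-- On the open unit disc the value series converges (absolutely). [cite: Washington1997, §7.2] -/
theorem summable_of_norm_lt_one {x : ℂ_[p]} (hx : ‖x‖ < 1) :
    Summable fun k : ℕ ↦ ((PowerSeries.coeff k Q : PadicComplexInt p) : ℂ_[p]) * x ^ k :=
  (summable_geometric_of_lt_one (norm_nonneg x) hx).of_norm_bounded (norm_term_le_pow Q x)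

/-- **Values exist on the open unit disc**: for `‖x‖ < 1` there is `v` with `IntSeries.HasValueAt Q x v`
(so the `∃ v` clauses of the tree's `p`-adic `L`-function frames are never vacuous at such points).
[cite: Washington1997, §7.2] -/
theorem exists_hasValueAt {x : ℂ_[p]} (hx : ‖x‖ < 1) : ∃ v : ℂ_[p], IntSeries.HasValueAt Q x v :=
  ⟨_, (summable_of_norm_lt_one Q hx).hasSum⟩

variable {Q}

/-- **Integrality of values**: `‖Q(x)‖ ≤ 1` for `‖x‖ ≤ 1`. [cite: Washington1997, §7.2] -/
theorem norm_le_one_of_hasValueAt {x v : ℂ_[p]} (h : IntSeries.HasValueAt Q x v) (hx : ‖x‖ ≤ 1) :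
    ‖v‖ ≤ 1 := by
  rw [← h.tsum_eq]
  exact IsUltrametricDist.norm_tsum_le_of_forall_le_of_nonneg zero_le_one fun k ↦
    (norm_term_le_pow Q x k).trans (pow_le_one₀ (norm_nonneg _) hx)

/-- **ULTRAMETRIC TRANSFER `‖Q(x) − Q(0)‖ ≤ ‖x‖`** for `‖x‖ ≤ 1`: the tail `∑_{k ≥ 1} [T^k]Q · x^k` has every
term of norm `≤ ‖x‖^{k+1} ≤ ‖x‖` — the convergent-sum form of "`F(x) ≡ F(0) (mod x)`" (memo §1 (vi)).
[cite: Washington1997, §7.2] -/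
theorem norm_sub_constantCoeff_le {x v : ℂ_[p]} (h : IntSeries.HasValueAt Q x v) (hx : ‖x‖ ≤ 1) :
    ‖v - ((PowerSeries.constantCoeff Q : PadicComplexInt p) : ℂ_[p])‖ ≤ ‖x‖ := by
  have hs : Summable fun k : ℕ ↦ ((PowerSeries.coeff k Q : PadicComplexInt p) : ℂ_[p]) * x ^ k :=
    h.summable
  have htail : v - ((PowerSeries.constantCoeff Q : PadicComplexInt p) : ℂ_[p]) =
      ∑' k : ℕ, ((PowerSeries.coeff (k + 1) Q : PadicComplexInt p) : ℂ_[p]) * x ^ (k + 1) := by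
    rw [← h.tsum_eq, hs.tsum_eq_zero_add, pow_zero, mul_one,
      PowerSeries.coeff_zero_eq_constantCoeff_apply, add_sub_cancel_left]
  rw [htail]
  refine IsUltrametricDist.norm_tsum_le_of_forall_le_of_nonneg (norm_nonneg x) fun k ↦
    (norm_term_le_pow Q x (k + 1)).trans ?_
  rw [pow_succ]
  exact mul_le_of_le_one_left (norm_nonneg x) (pow_le_one₀ (norm_nonneg _) hx)

/-- **(c)** `‖Q(x)‖ ≤ max ‖Q(0)‖ ‖x‖` (additively `ord Q(x) ≥ min(ord Q(0), ord x)`).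
[cite: Serre1979, Ch. II §1] -/
theorem norm_le_max {x v : ℂ_[p]} (h : IntSeries.HasValueAt Q x v) (hx : ‖x‖ ≤ 1) :
    ‖v‖ ≤ max ‖((PowerSeries.constantCoeff Q : PadicComplexInt p) : ℂ_[p])‖ ‖x‖ := by
  set c := ((PowerSeries.constantCoeff Q : PadicComplexInt p) : ℂ_[p])
  calc ‖v‖ = ‖c + (v - c)‖ := by rw [add_sub_cancel]
    _ ≤ max ‖c‖ ‖v - c‖ := IsUltrametricDist.norm_add_le_max _ _
    _ ≤ max ‖c‖ ‖x‖ := max_le_max le_rfl (norm_sub_constantCoeff_le h hx)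

/-- **(c′)** `‖Q(0)‖ ≤ max ‖Q(x)‖ ‖x‖` (additively `ord Q(0) ≥ min(ord Q(x), ord x)`).
[cite: Serre1979, Ch. II §1] -/
theorem norm_constantCoeff_le_max {x v : ℂ_[p]} (h : IntSeries.HasValueAt Q x v) (hx : ‖x‖ ≤ 1) :
    ‖((PowerSeries.constantCoeff Q : PadicComplexInt p) : ℂ_[p])‖ ≤ max ‖v‖ ‖x‖ := by
  set c := ((PowerSeries.constantCoeff Q : PadicComplexInt p) : ℂ_[p])
  calc ‖c‖ = ‖v + -(v - c)‖ := by rw [← sub_eq_add_neg, sub_sub_cancel]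
    _ ≤ max ‖v‖ ‖-(v - c)‖ := IsUltrametricDist.norm_add_le_max _ _
    _ = max ‖v‖ ‖v - c‖ := by rw [norm_neg]
    _ ≤ max ‖v‖ ‖x‖ := max_le_max le_rfl (norm_sub_constantCoeff_le h hx)

/-- **(a)** `‖x‖ < ‖Q(x)‖ → ‖Q(0)‖ = ‖Q(x)‖` ("`ord F(x) < ord x ⇒ ord F(0) = ord F(x)`"): the
perturbation `Q(x) − Q(0)` is strictly smaller than `Q(x)`. [cite: Serre1979, Ch. II §1] -/
theorem norm_constantCoeff_eq_of_lt {x v : ℂ_[p]} (h : IntSeries.HasValueAt Q x v) (hx : ‖x‖ ≤ 1)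
    (hlt : ‖x‖ < ‖v‖) : ‖((PowerSeries.constantCoeff Q : PadicComplexInt p) : ℂ_[p])‖ = ‖v‖ := by
  set c := ((PowerSeries.constantCoeff Q : PadicComplexInt p) : ℂ_[p])
  have hε : ‖-(v - c)‖ < ‖v‖ := by
    rw [norm_neg]; exact (norm_sub_constantCoeff_le h hx).trans_lt hlt
  calc ‖c‖ = ‖v + -(v - c)‖ := by rw [← sub_eq_add_neg, sub_sub_cancel]
    _ = max ‖v‖ ‖-(v - c)‖ := IsUltrametricDist.norm_add_eq_max_of_norm_ne_norm (ne_of_gt hε)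
    _ = ‖v‖ := max_eq_left hε.le

/-- **(b)** `‖x‖ < ‖Q(0)‖ → ‖Q(x)‖ = ‖Q(0)‖` ("`ord F(0) < ord x ⇒ ord F(x) = ord F(0)`").
[cite: Serre1979, Ch. II §1] -/
theorem norm_eq_of_lt {x v : ℂ_[p]} (h : IntSeries.HasValueAt Q x v) (hx : ‖x‖ ≤ 1)
    (hlt : ‖x‖ < ‖((PowerSeries.constantCoeff Q : PadicComplexInt p) : ℂ_[p])‖) :
    ‖v‖ = ‖((PowerSeries.constantCoeff Q : PadicComplexInt p) : ℂ_[p])‖ := by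
  set c := ((PowerSeries.constantCoeff Q : PadicComplexInt p) : ℂ_[p])
  have hε : ‖v - c‖ < ‖c‖ := (norm_sub_constantCoeff_le h hx).trans_lt hlt
  calc ‖v‖ = ‖c + (v - c)‖ := by rw [add_sub_cancel]
    _ = max ‖c‖ ‖v - c‖ := IsUltrametricDist.norm_add_eq_max_of_norm_ne_norm (ne_of_gt hε)
    _ = ‖c‖ := max_eq_left hε.le

/-- **(a)'s non-vanishing corollary**: `‖x‖ < ‖Q(x)‖` forces `Q(0) ≠ 0` ("`ℒ(𝟙) ≠ 0` is certified, not
assumed", memo §0 3.). [cite: Serre1979, Ch. II §1] -/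
theorem constantCoeff_ne_zero_of_lt {x v : ℂ_[p]} (h : IntSeries.HasValueAt Q x v) (hx : ‖x‖ ≤ 1)
    (hlt : ‖x‖ < ‖v‖) : ((PowerSeries.constantCoeff Q : PadicComplexInt p) : ℂ_[p]) ≠ 0 := by
  intro h0
  have := norm_constantCoeff_eq_of_lt h hx hlt
  rw [h0, norm_zero] at this
  exact (lt_irrefl _) ((norm_nonneg x).trans_lt (this ▸ hlt))

end IntSeries

end Literature.NumberTheory.EllipticCurves

/-! ## §2. The instances for the Rubin-type `p`-adic `L`-function datum -/

namespace Literature.NumberTheory.EllipticCurves.BurungaleKobayashiNakamuraOta2026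

open _root_.WeierstrassCurve

namespace RubinPadicLFunctionData

variable {W : WeierstrassCurve ℚ} {p : ℕ} [Fact p.Prime] {K : Type} [Field K] [NumberField K]
  {c : K ≃ₐ[ℚ] K} {𝔭 : HeightOneSpectrum (𝓞 K)} {κ : ZpExtension K p} {γ : absoluteGaloisGroup K}
  {ι : PadicAlgCl p ≃+* ℂ} {φ : HeckeCharacter K} {Ω : ℂ} {𝓔 : AcDualExpSystem W p K 𝔭 κ ι}
  [W.IsElliptic] {D : EllipticUnitClassData W p K 𝔭 κ γ ι φ Ω 𝓔}
  (R : RubinPadicLFunctionData W p K c 𝔭 κ γ ι φ Ω 𝓔 D)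

/-- `ℒ` has a value at every point of the open unit disc (in particular at every `T = ξ̂(γ) − 1`, `ξ̂(γ)`
a principal unit). [cite: BurungaleKobayashiNakamuraOta2026, Thm. 4.12 (arXiv:2608.06879 p. 32) ("the homomorphism `Λ_ac → ℚ̄_p` induced by" a character)] -/
theorem exists_hasValueAt {x : ℂ_[p]} (hx : ‖x‖ < 1) : ∃ v : ℂ_[p], IntSeries.HasValueAt R.L x v :=
  IntSeries.exists_hasValueAt R.L hx

/-- Values of `ℒ` are integral: `‖ℒ(x)‖ ≤ 1` on the closed unit disc (where they exist).
[cite: BurungaleKobayashiNakamuraOta2026, Def. 4.7 (1) (arXiv:2608.06879 p. 27) (`ℒ ∈ Λ_ac`)] -/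
theorem norm_le_one_of_hasValueAt {x v : ℂ_[p]} (h : IntSeries.HasValueAt R.L x v) (hx : ‖x‖ ≤ 1) :
    ‖v‖ ≤ 1 :=
  IntSeries.norm_le_one_of_hasValueAt h hx

/-- **Memo THEOREM (2) shape**: if `‖x‖ < ‖ℒ(x)‖` (additively `ord ℒ(ξ) < ord x`) then
`‖[T⁰]ℒ‖ = ‖ℒ(x)‖` and `[T⁰]ℒ ≠ 0` — the bottom value `𝟙(ℒ)` is read off the value at `ξ` with `ℒ(𝟙) ≠ 0`
CERTIFIED. [cite: BurungaleKobayashiNakamuraOta2026, Thm. 4.12 (arXiv:2608.06879 p. 32) (the values packaged)] [cite: Serre1979, Ch. II §1] -/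
theorem norm_constantCoeff_eq_of_lt {x v : ℂ_[p]} (h : IntSeries.HasValueAt R.L x v) (hx : ‖x‖ ≤ 1)
    (hlt : ‖x‖ < ‖v‖) :
    ‖((PowerSeries.constantCoeff R.L : PadicComplexInt p) : ℂ_[p])‖ = ‖v‖ ∧
      ((PowerSeries.constantCoeff R.L : PadicComplexInt p) : ℂ_[p]) ≠ 0 :=
  ⟨IntSeries.norm_constantCoeff_eq_of_lt h hx hlt, IntSeries.constantCoeff_ne_zero_of_lt h hx hlt⟩

/-- **Memo THEOREM (3) shape**: if `‖x‖ < ‖[T⁰]ℒ‖` (additively `λ₀ < ord x`) then `‖ℒ(x)‖ = ‖[T⁰]ℒ‖`.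
[cite: BurungaleKobayashiNakamuraOta2026, Thm. 4.12 (arXiv:2608.06879 p. 32) (the values packaged)] [cite: Serre1979, Ch. II §1] -/
theorem norm_eq_constantCoeff_of_lt {x v : ℂ_[p]} (h : IntSeries.HasValueAt R.L x v) (hx : ‖x‖ ≤ 1)
    (hlt : ‖x‖ < ‖((PowerSeries.constantCoeff R.L : PadicComplexInt p) : ℂ_[p])‖) :
    ‖v‖ = ‖((PowerSeries.constantCoeff R.L : PadicComplexInt p) : ℂ_[p])‖ :=
  IntSeries.norm_eq_of_lt h hx hlt

/-- **Memo THEOREM (4) shape**: always `‖ℒ(x)‖ ≤ max ‖[T⁰]ℒ‖ ‖x‖` and `‖[T⁰]ℒ‖ ≤ max ‖ℒ(x)‖ ‖x‖`.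
[cite: BurungaleKobayashiNakamuraOta2026, Thm. 4.12 (arXiv:2608.06879 p. 32) (the values packaged)] [cite: Serre1979, Ch. II §1] -/
theorem norm_le_max_and {x v : ℂ_[p]} (h : IntSeries.HasValueAt R.L x v) (hx : ‖x‖ ≤ 1) :
    ‖v‖ ≤ max ‖((PowerSeries.constantCoeff R.L : PadicComplexInt p) : ℂ_[p])‖ ‖x‖ ∧
      ‖((PowerSeries.constantCoeff R.L : PadicComplexInt p) : ℂ_[p])‖ ≤ max ‖v‖ ‖x‖ :=
  ⟨IntSeries.norm_le_max h hx, IntSeries.norm_constantCoeff_le_max h hx⟩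

/-- **The transfer read through Thm. 7.2 at `𝟙`**: under `ε(φ) = −1`, if `‖x‖ < ‖ℒ(x)‖` then
`‖exp*_ω(𝟙(v_{−ε}))‖ · ‖log_ω(loc_𝔭 z(𝟙))‖ = ‖ℒ(x)‖` — the value at a de Rham character close to `𝟙` pins
the norm of the bottom logarithm times the bottom period (the quantity the K7r line compares with the
local bottom index exponent under its own "unit bottom period" input).
[cite: BurungaleKobayashiNakamuraOta2026, Thm. 7.2 (arXiv:2608.06879 p. 41) (claim; preprint)] [cite: Serre1979, Ch. II §1] -/
theorem norm_bottomPeriod_mul_logω_eq_of_lt (hε : IsCentralRootNumber φ (-1)) {x v : ℂ_[p]}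
    (h : IntSeries.HasValueAt R.L x v) (hx : ‖x‖ ≤ 1) (hlt : ‖x‖ < ‖v‖) :
    ‖R.bottomPeriod‖ * ‖R.logω ((W.baseChange K).localTorsionResPi
        (closureEmb (K := K) (𝔭.adicCompletion K)) p (κ.layerSubgroup 0) (D.z 0))‖ = ‖v‖ := by
  rw [← R.norm_constantCoeff_eq hε, IntSeries.norm_constantCoeff_eq_of_lt h hx hlt]

end RubinPadicLFunctionData

end Literature.NumberTheory.EllipticCurves.BurungaleKobayashiNakamuraOta2026

end
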